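import Summits.KontsevichZagierPeriods.KontsevichZagierPeriods.Theorems.InverseLandauTateLiftingTranscSector
import Summits.KontsevichZagierPeriods.KontsevichZagierPeriods.Theorems.GrothendieckGpcLegendreLemniscatic

/-!
# The ring join with algebraic coefficients: `evalP` is injective on `K₀[κ, ε, ϖ, W₂, W₄]`,
# unconditionally (by-product B2♯ of `Cruxes/SectorComplement/STUB-PLAN-stub_ringRemainder.md`;
# crux `Grothendieck.SectorComplement`, stmt-KontsevichZagierPeriods-11102)

Conjecture 1 of Kontsevich–Zagier in kernel form ON A SECTOR is injectivity of the evaluation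
`evalP : P →+* ℝ` on a subring of the formal period ring `P = FormalRep ⧸ relations`. The registered stub
`stub_ringRemainder` of line `containment-join` has as antecedent injectivity on the `ℤ`-coefficient ring
join `ℤ[κ, ε, ϖ, W₂, W₄]` (`κ = ⟦kRep⟧`, `ε = ⟦eRep⟧`, `ϖ` any representation of `π` on `ℝ`, `W₂, W₄` the
admissible word classes of weights `2`, `4`), a theorem (`ringJoinKernel_holds`). This file lands the
SHARPER unconditional sector obtained by adjoining ALL dimension-zero classes (the real algebraic numbers
`K₀`):

* §1 **`piClass_eq`** — Legendre's relation read in `P` and solved for `ϖ`: `ϖ = 4κε − 2κ²`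
  (the landed transfer `GpcLegendreLemniscatic_proof`, stmt-0280, through `aeval_formalPeriod_legendre`);
  hence `ϖ ∈ R` for every subring `R ∋ κ, ε` (`piClass_mem`);
* §2 **`ringJoinKernel_algebraic`** — `evalP` is injective on `K₀[κ, ε, ϖ, W₂, W₄]`: by §1 this ring is
  `K₀[κ, ε]` (injective: `kESectorRingKernel`, Chudnovsky's theorem + the dimension-zero ring) saturated by
  the word classes, which are torsion over any subring containing `ϖ` (`exists_nsmul_mem_of_wordClass`,
  `stub_saturationKernel`). EVERY polynomial identity with real-algebraic coefficients among
  `K(1/√2), E(1/√2), π, ζ(2), ζ(4), ζ(3,1), ζ(2,2), ζ(2,1,1)` is derivable by the three rules;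
* §3 corollaries at the level of representations (kernel form for formal combinations; equal values ⇒
  KZ-equivalent) and the read-back `remainder_algebraic_iff_summit`: enlarging the antecedent ring of the
  stub from `ℤ` to `K₀` coefficients does not move the remainder — it is again the Statement.

No definitions, no named-fact hypotheses; axioms standard.

References: M. Kontsevich, D. Zagier, *Periods* (2001), §1.2 (Conjecture 1), §4.1; G. V. Chudnovsky,
*Contributions to the theory of transcendental numbers* (1984), Ch. 7 §2; F. Lindemann (1882).
-/

noncomputable section

open Set
open Literature.NumberTheory.Transcendental
open Literature.NumberTheory.Transcendental.KZ
open MvPolynomial (aeval X C)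
open Summit.KontsevichZagierPeriods.KontsevichZagierPeriods.Theses.Grothendieck
open Summit.KontsevichZagierPeriods.Grothendieck.GpcLegendreLemniscaticNegative (kRep eRep)
open Summit.KontsevichZagierPeriods.Grothendieck.LemniscaticSectorGlue (aeval_formalPeriod_legendre)
open Summit.KontsevichZagierPeriods.Grothendieck.GpcLegendreLemniscaticLine (GpcLegendreLemniscatic_proof)
open Summit.KontsevichZagierPeriods.MzvKernelInKZ.Negative (genSetAdm)
open Summit.KontsevichZagierPeriods.InverseLandau (kESectorRingKernel)

namespace Summit.KontsevichZagierPeriods.Grothendieck.SectorComplementRingJoin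

/-! ## §1 Legendre's relation in `P`, solved for `ϖ` -/

/-- **Legendre in the formal period ring, solved for `ϖ`**: for every representation `p` of `π` on `ℝ`
(`domain = univ`, integrand `1/(1+x²)`), `⟦p⟧ = 4κε − 2κ²` in `P` — the landed transfer
`GpcLegendreLemniscatic_proof` (stmt-0280) read through `aeval_formalPeriod_legendre`. Hence the class of
`π` lies in `ℤ[κ, ε]` inside `P`. [cite: KontsevichZagier2001, §1.2, §4.1] -/
theorem piClass_eq (p : IntegralRep 1) (hpd : p.domain = univ)
    (hpi : p.integrand = fun x => 1 / (1 + x 0 ^ 2)) :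
    toFormalPeriod (of p) =
      4 * toFormalPeriod (of kRep) * toFormalPeriod (of eRep) - 2 * toFormalPeriod (of kRep) ^ 2 := by
  have h := aeval_formalPeriod_legendre GpcLegendreLemniscatic_proof p hpd hpi
  simp only [map_sub, map_mul, map_pow, MvPolynomial.aeval_X, map_ofNat] at h
  simp only [Matrix.cons_val_zero, Matrix.cons_val_one, Matrix.head_cons, Matrix.cons_val_two,
    Matrix.tail_cons] at h
  linear_combination -h

/-- **The class of `π` lies in every subring containing `κ` and `ε`.** [cite: KontsevichZagier2001, §4.1] -/
theorem piClass_mem (p : IntegralRep 1) (hpd : p.domain = univ)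
    (hpi : p.integrand = fun x => 1 / (1 + x 0 ^ 2)) (R : Subring FormalPeriodRing)
    (hκ : toFormalPeriod (of kRep) ∈ R) (hε : toFormalPeriod (of eRep) ∈ R) :
    toFormalPeriod (of p) ∈ R := by
  rw [piClass_eq p hpd hpi]
  exact R.sub_mem (R.mul_mem (R.mul_mem (ofNat_mem R 4) hκ) hε)
    (R.mul_mem (ofNat_mem R 2) (R.pow_mem hκ 2))

/-! ## §2 The ring join with algebraic coefficients (UNCONDITIONAL) -/

/-- **`evalP` is injective on `K₀[κ, ε, ϖ, W₂, W₄]`, UNCONDITIONALLY**: the ring join of the stub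
`stub_ringRemainder` with ALL dimension-zero classes (real-algebraic coefficients) adjoined. Proof: by
`piClass_mem` the generator `ϖ` already lies in `K₀[κ, ε]`, on which `evalP` is injective
(`kESectorRingKernel`: Chudnovsky's algebraic independence of `K(1/√2), E(1/√2)` + the dimension-zero
ring), and the word classes are torsion over any subring containing `ϖ` (`exists_nsmul_mem_of_wordClass`),
so the saturation lemma `stub_saturationKernel` (torsion-freeness of `P`) finishes. Every polynomial
identity with real-algebraic coefficients among `K(1/√2), E(1/√2), π, ζ(2), ζ(4), ζ(3,1), ζ(2,2), ζ(2,1,1)`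
is derivable by the three rules of the calculus.
[cite: KontsevichZagier2001, §1.2, Conjecture 1] [cite: Chudnovsky1984, Ch. 7 §2 Corollary 2.3] -/
theorem ringJoinKernel_algebraic :
    ∀ (p : IntegralRep 1), p.domain = Set.univ → (p.integrand = fun x => 1 / (1 + x 0 ^ 2)) →
      ∀ x ∈ Subring.closure
          (Set.range (fun b : IntegralRep 0 => toFormalPeriod (of b)) ∪
            ({toFormalPeriod (of kRep), toFormalPeriod (of eRep), toFormalPeriod (of p)} ∪
              toFormalPeriod '' (genSetAdm 2 ∪ genSetAdm 4))),
        evalP x = 0 → x = 0 := by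
  intro p hpd hpi
  set R₁ : Subring FormalPeriodRing := Subring.closure
    (Set.range (fun b : IntegralRep 0 => toFormalPeriod (of b)) ∪
      Set.range (![toFormalPeriod (of kRep), toFormalPeriod (of eRep)] :
        Fin 2 → FormalPeriodRing)) with hR₁
  have hR₁ker : ∀ y ∈ R₁, evalP y = 0 → y = 0 := kESectorRingKernel
  have hκ : toFormalPeriod (of kRep) ∈ R₁ := Subring.subset_closure (Or.inr ⟨0, rfl⟩)
  have hε : toFormalPeriod (of eRep) ∈ R₁ := Subring.subset_closure (Or.inr ⟨1, rfl⟩)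
  have hϖ : toFormalPeriod (of p) ∈ R₁ := piClass_mem p hpd hpi R₁ hκ hε
  have hT := exists_nsmul_mem_of_wordClass p hpd hpi R₁ hϖ
  intro x hx
  refine stub_saturationKernel R₁ _ hR₁ker hT x (Subring.closure_mono ?_ hx)
  rintro y (⟨b, rfl⟩ | hy | hy)
  · exact Or.inl (Subring.subset_closure (Or.inl ⟨b, rfl⟩))
  · rcases hy with rfl | rfl | rfl
    · exact Or.inl hκ
    · exact Or.inl hε
    · exact Or.inl hϖ
  · exact Or.inr hy

/-! ## §3 Corollaries at the level of representations, and the read-back -/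

/-- **Kernel form on `K₀[κ, ε, ϖ, W₂, W₄]`, for formal combinations**: a formal `ℤ`-combination of
representations whose class lies in the algebraic ring join and whose value vanishes is a relation —
unconditionally. [cite: KontsevichZagier2001, §1.2, Conjecture 1] -/
theorem mem_relations_of_toFormalPeriod_mem_ringJoinAlgebraic (p : IntegralRep 1)
    (hpd : p.domain = Set.univ) (hpi : p.integrand = fun x => 1 / (1 + x 0 ^ 2)) {c : FormalRep}
    (hc : toFormalPeriod c ∈ Subring.closure
      (Set.range (fun b : IntegralRep 0 => toFormalPeriod (of b)) ∪
        ({toFormalPeriod (of kRep), toFormalPeriod (of eRep), toFormalPeriod (of p)} ∪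
          toFormalPeriod '' (genSetAdm 2 ∪ genSetAdm 4))))
    (h0 : eval c = 0) : c ∈ relations := by
  rw [← toFormalPeriod_eq_zero_iff]
  exact ringJoinKernel_algebraic p hpd hpi _ hc (by rwa [evalP_toFormalPeriod])

/-- **Conjecture 1 on `K₀[κ, ε, ϖ, W₂, W₄]`, two-representation form**: two representations (of any
dimensions) whose classes lie in the algebraic ring join and which have the same value are KZ-equivalent —
unconditionally. [cite: KontsevichZagier2001, §1.2, Conjecture 1] -/
theorem equivalent_of_mem_ringJoinAlgebraic (p : IntegralRep 1) (hpd : p.domain = Set.univ)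
    (hpi : p.integrand = fun x => 1 / (1 + x 0 ^ 2)) {n m : ℕ} (r : IntegralRep n)
    (r' : IntegralRep m)
    (hr : toFormalPeriod (of r) ∈ Subring.closure
      (Set.range (fun b : IntegralRep 0 => toFormalPeriod (of b)) ∪
        ({toFormalPeriod (of kRep), toFormalPeriod (of eRep), toFormalPeriod (of p)} ∪
          toFormalPeriod '' (genSetAdm 2 ∪ genSetAdm 4))))
    (hr' : toFormalPeriod (of r') ∈ Subring.closure
      (Set.range (fun b : IntegralRep 0 => toFormalPeriod (of b)) ∪
        ({toFormalPeriod (of kRep), toFormalPeriod (of eRep), toFormalPeriod (of p)} ∪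
          toFormalPeriod '' (genSetAdm 2 ∪ genSetAdm 4))))
    (hv : r.value = r'.value) : Equivalent r r' :=
  mem_relations_of_toFormalPeriod_mem_ringJoinAlgebraic p hpd hpi
    (by rw [map_sub]; exact Subring.sub_mem _ hr hr')
    (by rw [map_sub, eval_of, eval_of, hv, sub_self])

/-- **Read-back**: enlarging the antecedent ring of the stub `stub_ringRemainder` from `ℤ` to `K₀`
coefficients does not move the remainder — "injectivity of `evalP` on `K₀[κ, ε, ϖ, W₂, W₄]` → Statement"
is again EQUIVALENT to the Statement, because the antecedent is the theorem `ringJoinKernel_algebraic`.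
[cite: KontsevichZagier2001, §1.2, Conjecture 1] -/
theorem remainder_algebraic_iff_summit :
    ((∀ (p : IntegralRep 1), p.domain = Set.univ → (p.integrand = fun x => 1 / (1 + x 0 ^ 2)) →
      ∀ x ∈ Subring.closure
          (Set.range (fun b : IntegralRep 0 => toFormalPeriod (of b)) ∪
            ({toFormalPeriod (of kRep), toFormalPeriod (of eRep), toFormalPeriod (of p)} ∪
              toFormalPeriod '' (genSetAdm 2 ∪ genSetAdm 4))),
        evalP x = 0 → x = 0) → KontsevichZagierPeriods) ↔ KontsevichZagierPeriods :=
  ⟨fun hrem => hrem ringJoinKernel_algebraic, fun hs _ => hs⟩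

end Summit.KontsevichZagierPeriods.Grothendieck.SectorComplementRingJoin

end
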